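import Summits.ABC.ABC.Theses.RibetTakahashiSplit
import Summits.ABC.ABC.Theorems.RibetTakahashiSplitManyPrimeValuationProductFreyReductions
import Summits.ABC.ABC.Theorems.ManyPrimeValuationProduct.Negative.CruxConstantDoublyExponential

/-!
# Disproof of `ManyPrimeValuationProductSemistableFrey` (crux R2 = `stmt-ABC-15174`, route
`RibetTakahashiSplit`) — findings of the standing crux disprover `cdisprove-stmt-ABC-15174`, cycle 1

R2: `∀ ε > 0 ∃ C ∀ W/ℚ elliptic`, SEMISTABLE (`p² ∤ N_W` for every prime `p`), `ℚ`-isomorphic to a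
twisted Frey–Hellegouarch curve `freyCurve (d a) (d b)` (`a, b` coprime, `ab(a+b) ≠ 0`, `d ∣ 2`),
with `≥ 4` odd multiplicative primes: `T(W) := ∏_{p ∥ N} ord_p Δ_min(W) ≤ C · N_W^ε`.
Prose only in docstrings; everything below is `lean check`ed (rc 0, no `sorry`).  VERDICT OF THE
CYCLE: **no kill is possible short of `¬ ABC`**; what is certified is which hypothesis is
load-bearing (`0 < ε` only), that every natural strengthening is false ON THE SEMISTABLE FREY CLASS
ITSELF, and how large admissible constants must be.  Index:

* §1 TRUTH LEVEL (why R2 resists): `R2 ⇐ r2F ⇐ r2 ⇐ r3′`, `⇐ Szpiro ⇐ ABC` — all already in the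
  tree (`RibetTakahashiSplitManyPrimeValuationProductFreyReductions`, `…Bootstrap`); collected here as
  `semistableFrey_of_frey`, `…_of_manyPrime`, `…_of_weightedSzpiro`, `…_of_szpiro`, `…_of_abc` and the
  contrapositive `not_abc_of_not_semistableFrey : ¬ R2 → ¬ ABC`.  The exact gap to r2F is the tree's
  `manyPrimeValuationProductFrey_iff_semistableFrey_and_residual` (r2F ↔ R2 ∧ Residual, Residual =
  Frey curves of triples with `16 ∤ abc`, additive at `2`).
* §2 NO CLASS HYPOTHESIS IS LOAD-BEARING AT TRUTH LEVEL: the hypothesis-FREE statement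
  `∀ ε > 0 ∃ C ∀ W elliptic, T(W) ≤ C N^ε` (no semistability, no Frey model, no prime count) already
  follows from Szpiro, hence from `ABC` (`valuationProduct_all_of_szpiro`, `valuationProduct_all_of_abc`,
  via the tree's class-parametric `valuationProduct_le_of_polySzpiro`).  So "semistable", "Frey" and
  "`4 ≤ #`" are MECHANISM hypotheses (Pasten Thm 6.1(b) admissible factorisations `N = DM` need `≥ 4`
  odd multiplicative primes; semistability at `2` is what makes the Manin constant of the class
  uniformly bounded without Pasten Cor. 10.2), not truth conditions: dropping any of them gives a
  statement that is still a consequence of the summit, hence equally irrefutable.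
* §3 `0 < ε` IS LOAD-BEARING, and the natural strengthenings are FALSE on the class of R2 (witness
  family `F(M, j) = freyCurve (-1) (32 M^j) : y² = x(x+1)(x+32M^j)`, conductor `rad(32 M^j (32 M^j − 1))`
  SQUAREFREE, hence in the class with `d = 1`; `T ≥ (2j)^{#P}` for any set `P` of odd primes of `M`,
  `N < 64 M^{j+1}` — tree files `ManyPrimeValuationProduct/Negative/WindowCensusFamily`, `ConstantBlowup`):
  `semistableFrey_false_without_epsilon k` (ε-free false for EVERY prime-count threshold `k`),
  `semistableFrey_false_uniform_constant` (`∃ C ∀ ε` false), `semistableFrey_false_polylog m`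
  (`T ≤ C (log N)^m` false for every `m`), `semistableFrey_single_exponent_unbounded`
  (already `max_{p ∥ N} ord_p Δ_min` is unbounded on the class).
* §4 CONSTANTS: `semistableFrey_constant_at_one_twentieth` (`C_{1/20} ≥ 2¹²⁶`),
  `semistableFrey_constant_at_one_fiftieth` (`C_{1/50} ≥ 2²⁵¹`), `semistableFrey_constant_ge_exp_exp`
  (`C_ε ≥ exp exp (1/(12ε))` for `ε ≤ 1/320`): the constant is doubly exponential in `1/ε`, as for the
  divisor bound — a proof of R2 through any mechanism must produce constants of that size.
  (§3–§4 are filed for landing as `Theorems/ManyPrimeValuationProductSemistableFrey/Negative/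
  {StrengtheningsFalse,ConstantDoublyExponential}.lean`; this work file re-derives the short ones and
  imports the parent crux's Chebyshev machinery for the last.)
* §5 NON-VACUITY and class remarks: the hypotheses are jointly satisfiable (`class_nonempty`:
  `F(1155, 1)`); the class contains curves with GOOD reduction at `2` (`v₂(abc) = 4`) as well as
  multiplicative (`v₂(abc) ≥ 5`); the twist parameter `d = ±2` never yields a semistable curve (paper:
  a `±2`-twist is ramified at `2`; not certified — would need the `2`-adic conductor of twists, absent
  from the tree), so effectively `d = ±1`; the product in the conclusion INCLUDES `p = 2` when `2 ∥ N`
  (`ord₂ Δ_min = 2 v₂(abc) − 8`), harmless at the `N^ε` scale.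
* §6 MECHANISM level (prose): the only refutable content is the informal `EigenformLowerBound`
  (`‖f_{D,M}‖² ≥ N^{1−o(1)}` for the integral JL transfer); searched again this cycle — no published
  family with `‖f_{D,M}‖² ≤ N^{1−c}‖f‖²` (Prasanna 2006 integrality gives `β ≥ 1` only; BKM 2021 /
  Moakher 2024 compute `p`-parts, never archimedean size).  Kill criterion (iii) of the route stands
  unrealised.
* Targets: none this cycle (no line picked, `stuck_stubs = []`).
-/

-- `Summit.<Summit>.<Problem>`: for the single-conjunct summit `ABC` the duplicate `ABC.ABC` is mandated.
set_option linter.dupNamespace false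

namespace Summit.ABC.ABC.Cruxes.ManyPrimeValuationProductSemistableFrey.Disproof

open Summit.ABC.ABC.Theses.RibetTakahashiSplit
open Summit.ABC.ABC.Theorems
open Literature.NumberTheory.EllipticCurves UniqueFactorizationMonoid Real Finset Chebyshev
open Summit.ABC.ABC.Theorems.ManyPrimeValuationProduct.Negative

noncomputable section

/-! ## §1 Truth level: R2 sits below r2F, r2, r3′, Szpiro and `ABC` -/

/-- r2F ⟹ R2 (tree: `manyPrimeValuationProductSemistableFrey_of_frey`; forget `p ≠ 2`). [folklore] -/
theorem semistableFrey_of_frey (h : ManyPrimeValuationProductFrey) :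
    ManyPrimeValuationProductSemistableFrey :=
  manyPrimeValuationProductSemistableFrey_of_frey h

/-- r2 ⟹ R2. [folklore] -/
theorem semistableFrey_of_manyPrime (h : ManyPrimeValuationProduct) :
    ManyPrimeValuationProductSemistableFrey :=
  semistableFrey_of_frey (manyPrimeValuationProductFrey_of_manyPrimeValuationProduct h)

/-- r3′ ⟹ R2 (through the tree's bootstrap `WeightedSzpiroBound → r2`). [folklore] -/
theorem semistableFrey_of_weightedSzpiro (h : WeightedSzpiroBound) :
    ManyPrimeValuationProductSemistableFrey :=
  semistableFrey_of_frey (manyPrimeValuationProductFrey_of_weightedSzpiroBound h)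

/-- Szpiro ⟹ R2 (conditional on the OPEN `SzpiroConjecture`). [folklore] -/
theorem semistableFrey_of_szpiro (h : SzpiroConjecture) : ManyPrimeValuationProductSemistableFrey :=
  semistableFrey_of_frey (manyPrimeValuationProductFrey_of_szpiro h)

/-- **`ABC` ⟹ R2**: the crux is a consequence of the summit. [folklore] -/
theorem semistableFrey_of_abc (h : _root_.ABC) : ManyPrimeValuationProductSemistableFrey :=
  semistableFrey_of_frey (manyPrimeValuationProductFrey_of_abc h)

/-- **Why R2 resists refutation:** a proof of `¬ R2` would be a disproof of the abc conjecture.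
[folklore] -/
theorem not_abc_of_not_semistableFrey (h : ¬ ManyPrimeValuationProductSemistableFrey) : ¬ _root_.ABC :=
  fun habc => h (semistableFrey_of_abc habc)

/- The exact gap between R2 and r2F is the tree's
`Summit.ABC.ABC.Theorems.manyPrimeValuationProductFrey_iff_semistableFrey_and_residual`:
r2F ↔ R2 ∧ (r2F on curves additive at `2` whose Frey witness has `16 ∤ ab(a+b)`). -/
example := @manyPrimeValuationProductFrey_iff_semistableFrey_and_residual

/-! ## §2 No hypothesis on the curve is load-bearing at truth level

The hypothesis-free valuation-product bound follows from Szpiro (tree: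
`ManyPrimeValuationProduct.valuationProduct_le_of_polySzpiro` with the trivial class), hence from
`ABC`.  Consequently each of "semistable", "Frey-isomorphic", "`4 ≤ #` odd multiplicative primes"
can be dropped without leaving the shadow of the summit: they are there for the MECHANISM. -/

/-- **Szpiro ⟹ `T(W) ≤ C_ε N_W^ε` for EVERY elliptic `W/ℚ`** (no class hypothesis at all). [folklore] -/
theorem valuationProduct_all_of_szpiro (h : SzpiroConjecture) :
    ∀ ε : ℝ, 0 < ε → ∃ C : ℝ, ∀ (W : WeierstrassCurve ℚ) [W.IsElliptic],
      ((∏ p ∈ (W.conductorNorm ℤ).primeFactors with ¬ p ^ 2 ∣ W.conductorNorm ℤ,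
          (W.minimalDiscriminantNorm ℤ).factorization p : ℕ) : ℝ) ≤ C * (W.conductorNorm ℤ : ℝ) ^ ε := by
  obtain ⟨C, hC⟩ := h 1 one_pos
  have main := ManyPrimeValuationProduct.valuationProduct_le_of_polySzpiro
    (P := fun _ => True) (K := (6 : ℝ) + 1) (C := C) (fun W _ _ => hC W)
  intro ε hε
  obtain ⟨C', hC'⟩ := main ε hε
  exact ⟨C', fun W _ => hC' W trivial⟩

/-- **`ABC` ⟹ the hypothesis-free valuation-product bound.** [folklore] -/
theorem valuationProduct_all_of_abc (h : _root_.ABC) :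
    ∀ ε : ℝ, 0 < ε → ∃ C : ℝ, ∀ (W : WeierstrassCurve ℚ) [W.IsElliptic],
      ((∏ p ∈ (W.conductorNorm ℤ).primeFactors with ¬ p ^ 2 ∣ W.conductorNorm ℤ,
          (W.minimalDiscriminantNorm ℤ).factorization p : ℕ) : ℝ) ≤ C * (W.conductorNorm ℤ : ℝ) ^ ε := by
  refine valuationProduct_all_of_szpiro (szpiro_of_abcLe_holds fun ε hε => ?_)
  obtain ⟨C, -, hC⟩ := (ABC_iff.mp h) ε hε
  exact ⟨C, fun a b c habc => (hC a b c habc).le⟩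

/-- R2 with ALL THREE class hypotheses dropped (`ManyPrimeValuationProductSemistableFrey` minus
semistability, Frey model and prime count) is still a consequence of `ABC` — so none of them can be
the source of a counterexample. [folklore] -/
theorem withoutClassHypotheses_of_abc (h : _root_.ABC) :
    ∀ ε : ℝ, 0 < ε → ∃ C : ℝ, ∀ (W : WeierstrassCurve ℚ) [W.IsElliptic],
      ((∏ p ∈ (W.conductorNorm ℤ).primeFactors with ¬ p ^ 2 ∣ W.conductorNorm ℤ,
          (W.minimalDiscriminantNorm ℤ).factorization p : ℕ) : ℝ) ≤ C * (W.conductorNorm ℤ : ℝ) ^ ε :=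
  valuationProduct_all_of_abc h

/-! ## §3 `0 < ε` is load-bearing; the natural strengthenings are false ON THE CLASS OF R2

Witnesses: `F(M, j) = freyCurve (-1) (32 M^j)` (tree `Negative/WindowCensusFamily`): squarefree
conductor (`family_not_sq_dvd` at EVERY prime), Frey witness `d = 1`, `≥ 4` odd multiplicative primes
once `1155 ∣ M`. -/

/-- `F(M, j)` carries the Frey witness of R2 (`d = 1`, `(a,b) = (−1, 32 M^j)`, `C' = 1`). [folklore] -/
theorem family_frey (M j : ℕ) (hM : 1 ≤ M) :
    ∃ (a b d : ℤ) (C' : WeierstrassCurve.VariableChange ℚ), IsCoprime a b ∧ a * b * (a + b) ≠ 0 ∧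
      d ∣ 2 ∧ C' • freyCurve (-1) (32 * (M : ℤ) ^ j) = freyCurve (d * a) (d * b) :=
  ⟨-1, 32 * (M : ℤ) ^ j, 1, 1, (family_hyps M j hM).1, (family_hyps M j hM).2.1, one_dvd _,
    by rw [one_smul, one_mul, one_mul]⟩

/-- Every set `P` of odd primes dividing `M` consists of odd multiplicative primes of `F(M, j)`. [folklore] -/
theorem family_card_le_card_filter (M j : ℕ) (hM : 1 ≤ M) (hj : 1 ≤ j) (P : Finset ℕ)
    (hP : ∀ p ∈ P, p.Prime ∧ p ≠ 2 ∧ p ∣ M) :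
    P.card ≤ (((freyCurve (-1) (32 * (M : ℤ) ^ j)).conductorNorm ℤ).primeFactors.filter
      (fun p => p ≠ 2 ∧ ¬ p ^ 2 ∣ (freyCurve (-1) (32 * (M : ℤ) ^ j)).conductorNorm ℤ)).card := by
  refine Finset.card_le_card fun p hp => ?_
  obtain ⟨hpp, hp2, hpM⟩ := hP p hp
  exact Finset.mem_filter.mpr ⟨family_mem_primeFactors M j hM hj hpp hpM, hp2,
    family_not_sq_dvd M j hM p hpp⟩

/-- **`F(M, j)` lies in the class of R2** (`1155 ∣ M`, `j ≥ 1`). [folklore] -/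
theorem family_in_class (M j : ℕ) (hM : 1 ≤ M) (hj : 1 ≤ j) (h1155 : 1155 ∣ M) :
    (∀ p : ℕ, p.Prime → ¬ p ^ 2 ∣ (freyCurve (-1) (32 * (M : ℤ) ^ j)).conductorNorm ℤ) ∧
    (∃ (a b d : ℤ) (C' : WeierstrassCurve.VariableChange ℚ), IsCoprime a b ∧ a * b * (a + b) ≠ 0 ∧
      d ∣ 2 ∧ C' • freyCurve (-1) (32 * (M : ℤ) ^ j) = freyCurve (d * a) (d * b)) ∧
    4 ≤ (((freyCurve (-1) (32 * (M : ℤ) ^ j)).conductorNorm ℤ).primeFactors.filter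
      (fun p => p ≠ 2 ∧ ¬ p ^ 2 ∣ (freyCurve (-1) (32 * (M : ℤ) ^ j)).conductorNorm ℤ)).card :=
  ⟨fun p hp => family_not_sq_dvd M j hM p hp, family_frey M j hM, family_four_le_card M j hM hj h1155⟩

/-- R2 WITHOUT `ε` (i.e. at `ε = 0`), with an arbitrary threshold `k` on the odd multiplicative primes. -/
def WithoutEpsilon (k : ℕ) : Prop :=
  ∃ C : ℝ, ∀ (W : WeierstrassCurve ℚ) [W.IsElliptic],
    (∀ p : ℕ, p.Prime → ¬ p ^ 2 ∣ W.conductorNorm ℤ) →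
    (∃ (a b d : ℤ) (C' : WeierstrassCurve.VariableChange ℚ), IsCoprime a b ∧ a * b * (a + b) ≠ 0 ∧
      d ∣ 2 ∧ C' • W = freyCurve (d * a) (d * b)) →
    k ≤ ((W.conductorNorm ℤ).primeFactors.filter (fun p => p ≠ 2 ∧ ¬ p ^ 2 ∣ W.conductorNorm ℤ)).card →
    ((∏ p ∈ (W.conductorNorm ℤ).primeFactors with ¬ p ^ 2 ∣ W.conductorNorm ℤ,
      (W.minimalDiscriminantNorm ℤ).factorization p : ℕ) : ℝ) ≤ C

/-- **`ε` is load-bearing, for every threshold:** `WithoutEpsilon k` is false for all `k` (witness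
`F(n#, j)` with `π(n) − 1 ≥ max k 1`, `2j > C`).  Any proof of R2 must use `0 < ε`; raising `4` to any
`k` does not help. [folklore] -/
theorem semistableFrey_false_without_epsilon (k : ℕ) : ¬ WithoutEpsilon k := by
  rintro ⟨C, hC⟩
  obtain ⟨n, hn11, hK⟩ := exists_many_oddPrimes (max k 1)
  have hM : 1 ≤ primorial n := primorial_pos n
  have hP := oddPrimesLE_spec n
  obtain ⟨j, hj⟩ := exists_nat_gt C
  haveI := family_isElliptic (primorial n) (j + 1) hM
  have hcard := family_card_le_card_filter (primorial n) (j + 1) hM (by omega) _ hP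
  have h := hC (freyCurve (-1) (32 * ((primorial n : ℕ) : ℤ) ^ (j + 1)))
    (fun p hp => family_not_sq_dvd _ (j + 1) hM p hp) (family_frey _ (j + 1) hM)
    (le_trans ((le_max_left k 1).trans hK) hcard)
  have hT := family_pow_card_le_valuationProduct (primorial n) (j + 1) hM (by omega) _ hP
  have hP1 : 1 ≤ ((Nat.primesLE n).filter (· ≠ 2)).card := (le_max_right k 1).trans hK
  have h1 : 2 * (j + 1) ≤ (2 * (j + 1)) ^ ((Nat.primesLE n).filter (· ≠ 2)).card :=
    Nat.le_self_pow (by omega) _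
  have hge : ((2 * (j + 1) : ℕ) : ℝ) ≤ _ := Nat.cast_le.mpr (h1.trans hT)
  have := hge.trans h
  push_cast at this
  linarith

/-- R2 with `∃ C ∀ ε` (one constant for every `ε > 0`). -/
def UniformConstant : Prop :=
  ∃ C : ℝ, ∀ ε : ℝ, 0 < ε → ∀ (W : WeierstrassCurve ℚ) [W.IsElliptic],
    (∀ p : ℕ, p.Prime → ¬ p ^ 2 ∣ W.conductorNorm ℤ) →
    (∃ (a b d : ℤ) (C' : WeierstrassCurve.VariableChange ℚ), IsCoprime a b ∧ a * b * (a + b) ≠ 0 ∧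
      d ∣ 2 ∧ C' • W = freyCurve (d * a) (d * b)) →
    4 ≤ ((W.conductorNorm ℤ).primeFactors.filter (fun p => p ≠ 2 ∧ ¬ p ^ 2 ∣ W.conductorNorm ℤ)).card →
    ((∏ p ∈ (W.conductorNorm ℤ).primeFactors with ¬ p ^ 2 ∣ W.conductorNorm ℤ,
      (W.minimalDiscriminantNorm ℤ).factorization p : ℕ) : ℝ) ≤ C * (W.conductorNorm ℤ : ℝ) ^ ε

/-- **`C` must depend on `ε`:** `UniformConstant` is false (`ε → 0⁺` at a fixed curve). [folklore] -/
theorem semistableFrey_false_uniform_constant : ¬ UniformConstant := by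
  rintro ⟨C, hC⟩
  apply semistableFrey_false_without_epsilon 4
  refine ⟨C, fun W _ hss hfrey hcard => ?_⟩
  have hN0 : (0 : ℝ) < (W.conductorNorm ℤ : ℝ) := by
    exact_mod_cast WeierstrassCurve.conductorNorm_pos_holds W
  have hlim : Filter.Tendsto (fun ε : ℝ => C * (W.conductorNorm ℤ : ℝ) ^ ε) (nhdsWithin 0 (Set.Ioi 0))
      (nhds (C * (W.conductorNorm ℤ : ℝ) ^ (0 : ℝ))) :=
    ((Real.continuousAt_const_rpow hN0.ne').tendsto.const_mul C).mono_left nhdsWithin_le_nhds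
  rw [Real.rpow_zero, mul_one] at hlim
  refine ge_of_tendsto hlim ?_
  filter_upwards [self_mem_nhdsWithin] with ε hε
  exact hC ε hε W hss hfrey hcard

/-- R2 with `N^ε` replaced by `(log N)^m`. -/
def Polylog (m : ℕ) : Prop :=
  ∃ C : ℝ, ∀ (W : WeierstrassCurve ℚ) [W.IsElliptic],
    (∀ p : ℕ, p.Prime → ¬ p ^ 2 ∣ W.conductorNorm ℤ) →
    (∃ (a b d : ℤ) (C' : WeierstrassCurve.VariableChange ℚ), IsCoprime a b ∧ a * b * (a + b) ≠ 0 ∧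
      d ∣ 2 ∧ C' • W = freyCurve (d * a) (d * b)) →
    4 ≤ ((W.conductorNorm ℤ).primeFactors.filter (fun p => p ≠ 2 ∧ ¬ p ^ 2 ∣ W.conductorNorm ℤ)).card →
    ((∏ p ∈ (W.conductorNorm ℤ).primeFactors with ¬ p ^ 2 ∣ W.conductorNorm ℤ,
      (W.minimalDiscriminantNorm ℤ).factorization p : ℕ) : ℝ) ≤ C * Real.log (W.conductorNorm ℤ : ℝ) ^ m

/-- **No polylog bound on the class:** `Polylog m` is false for every `m` (`F(n#, j)`, `π(n) − 1 ≥ m+1`,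
`j → ∞`: `T ≥ (2j)^{m+1}`, `log N ≤ 2 j (log 64 + log n#)`). [folklore] -/
theorem semistableFrey_false_polylog (m : ℕ) : ¬ Polylog m := by
  rintro ⟨C, hC⟩
  obtain ⟨n, hn11, hK⟩ := exists_many_oddPrimes (max 4 (m + 1))
  set M : ℕ := primorial n with hMdef
  have hM : 1 ≤ M := primorial_pos n
  have h1155 : 1155 ∣ M := dvd_primorial_1155 n hn11
  have hP : ∀ p ∈ (Nat.primesLE n).filter (· ≠ 2), p.Prime ∧ p ≠ 2 ∧ p ∣ M := oddPrimesLE_spec n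
  have hPm : m + 1 ≤ ((Nat.primesLE n).filter (· ≠ 2)).card := (le_max_right _ _).trans hK
  have hMr : (1 : ℝ) ≤ (M : ℝ) := by exact_mod_cast hM
  set L : ℝ := Real.log 64 + Real.log M with hL
  have hlogM : 0 ≤ Real.log M := Real.log_nonneg hMr
  have hL0 : 0 < L := by
    have : (0 : ℝ) < Real.log 64 := Real.log_pos (by norm_num)
    linarith
  obtain ⟨j₀, hj₀⟩ := exists_nat_gt (|C| * L ^ m)
  set j : ℕ := j₀ + 1 with hjdef
  have hj1 : 1 ≤ j := by omega
  have hjC : |C| * L ^ m < j := lt_of_lt_of_le hj₀ (by rw [hjdef]; push_cast; linarith)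
  haveI := family_isElliptic M j hM
  set W := freyCurve (-1) (32 * (M : ℤ) ^ j) with hW
  obtain ⟨hss, hfrey, h4⟩ := family_in_class M j hM hj1 h1155
  have h := hC W hss hfrey h4
  have hT : ((2 * j : ℕ) : ℝ) ^ (m + 1) ≤
      ((∏ p ∈ (W.conductorNorm ℤ).primeFactors with ¬ p ^ 2 ∣ W.conductorNorm ℤ,
        (W.minimalDiscriminantNorm ℤ).factorization p : ℕ) : ℝ) := by
    have h1 : (2 * j) ^ (m + 1) ≤ (2 * j) ^ ((Nat.primesLE n).filter (· ≠ 2)).card :=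
      Nat.pow_le_pow_right (by omega) hPm
    exact_mod_cast h1.trans (family_pow_card_le_valuationProduct M j hM hj1 _ hP)
  have hNpos : (0 : ℝ) < (W.conductorNorm ℤ : ℝ) := by
    exact_mod_cast WeierstrassCurve.conductorNorm_pos_holds W
  have hN1 : (1 : ℝ) ≤ (W.conductorNorm ℤ : ℝ) := by
    exact_mod_cast WeierstrassCurve.conductorNorm_pos_holds W
  have hjr1 : (1 : ℝ) ≤ j := by exact_mod_cast hj1
  have hlogN : Real.log (W.conductorNorm ℤ : ℝ) ≤ (2 * j : ℝ) * L := by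
    have h1 : ((W.conductorNorm ℤ : ℕ) : ℝ) < 64 * (M : ℝ) ^ (j + 1) := by
      exact_mod_cast family_conductorNorm_lt M j hM
    have h2 : Real.log (W.conductorNorm ℤ : ℝ) ≤ Real.log (64 * (M : ℝ) ^ (j + 1)) :=
      Real.log_le_log hNpos h1.le
    rw [Real.log_mul (by norm_num) (by positivity), Real.log_pow] at h2
    have hj' : ((j + 1 : ℕ) : ℝ) ≤ 2 * j := by push_cast; linarith
    have h64 : (0 : ℝ) < Real.log 64 := Real.log_pos (by norm_num)
    calc Real.log (W.conductorNorm ℤ : ℝ) ≤ Real.log 64 + ((j + 1 : ℕ) : ℝ) * Real.log M := h2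
      _ ≤ (2 * j) * Real.log 64 + (2 * j) * Real.log M := by
          have := mul_le_mul_of_nonneg_right hj' hlogM
          nlinarith
      _ = (2 * j : ℝ) * L := by rw [hL]; ring
  have hlogN0 : 0 ≤ Real.log (W.conductorNorm ℤ : ℝ) := Real.log_nonneg hN1
  have hR : C * Real.log (W.conductorNorm ℤ : ℝ) ^ m ≤ |C| * ((2 * j : ℝ) * L) ^ m := by
    calc C * Real.log (W.conductorNorm ℤ : ℝ) ^ m ≤ |C| * Real.log (W.conductorNorm ℤ : ℝ) ^ m :=
          mul_le_mul_of_nonneg_right (le_abs_self C) (by positivity)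
      _ ≤ |C| * ((2 * j : ℝ) * L) ^ m :=
          mul_le_mul_of_nonneg_left (pow_le_pow_left₀ hlogN0 hlogN m) (abs_nonneg C)
  have hmain : ((2 * j : ℕ) : ℝ) ^ (m + 1) ≤ |C| * ((2 * j : ℝ) * L) ^ m := hT.trans (h.trans hR)
  have hjpos : (0 : ℝ) < (2 * j : ℝ) := by linarith
  have hpow : (0 : ℝ) < (2 * j : ℝ) ^ m := by positivity
  have hmain' : (2 * j : ℝ) * (2 * j : ℝ) ^ m ≤ (|C| * L ^ m) * (2 * j : ℝ) ^ m := by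
    have e1 : ((2 * j : ℕ) : ℝ) ^ (m + 1) = (2 * j : ℝ) * (2 * j : ℝ) ^ m := by push_cast; ring
    have e2 : |C| * ((2 * j : ℝ) * L) ^ m = (|C| * L ^ m) * (2 * j : ℝ) ^ m := by rw [mul_pow]; ring
    rw [← e1, ← e2]; exact hmain
  have hfin : (2 * j : ℝ) ≤ |C| * L ^ m := le_of_mul_le_mul_right hmain' hpow
  linarith

/-- **Even a single factor of `T` is unbounded on the class** (`ord_3 Δ_min (F(1155, j)) ≥ 2j`): the
`ε`-free form of the weaker single-exponent statement `max_{p ∥ N} ord_p Δ_min ≤ C` is false. [folklore] -/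
theorem semistableFrey_single_exponent_unbounded :
    ¬ ∃ C : ℝ, ∀ (W : WeierstrassCurve ℚ) [W.IsElliptic],
      (∀ p : ℕ, p.Prime → ¬ p ^ 2 ∣ W.conductorNorm ℤ) →
      (∃ (a b d : ℤ) (C' : WeierstrassCurve.VariableChange ℚ), IsCoprime a b ∧ a * b * (a + b) ≠ 0 ∧
        d ∣ 2 ∧ C' • W = freyCurve (d * a) (d * b)) →
      4 ≤ ((W.conductorNorm ℤ).primeFactors.filter
        (fun p => p ≠ 2 ∧ ¬ p ^ 2 ∣ W.conductorNorm ℤ)).card →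
      ∀ p ∈ (W.conductorNorm ℤ).primeFactors, ¬ p ^ 2 ∣ W.conductorNorm ℤ →
        (((W.minimalDiscriminantNorm ℤ).factorization p : ℕ) : ℝ) ≤ C := by
  rintro ⟨C, hC⟩
  obtain ⟨j₀, hj₀⟩ := exists_nat_gt C
  set j : ℕ := j₀ + 1 with hjdef
  have hM : 1 ≤ (1155 : ℕ) := by norm_num
  haveI := family_isElliptic 1155 j hM
  obtain ⟨hss, hfrey, h4⟩ := family_in_class 1155 j hM (by omega) (dvd_refl _)
  have h3 : (3 : ℕ) ∈ ((freyCurve (-1) (32 * ((1155 : ℕ) : ℤ) ^ j)).conductorNorm ℤ).primeFactors :=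
    family_mem_primeFactors 1155 j hM (by omega) Nat.prime_three (by norm_num)
  have h := hC (freyCurve (-1) (32 * ((1155 : ℕ) : ℤ) ^ j)) hss hfrey h4 3 h3
    (family_not_sq_dvd 1155 j hM 3 Nat.prime_three)
  have hv : 2 * j ≤ ((freyCurve (-1) (32 * ((1155 : ℕ) : ℤ) ^ j)).minimalDiscriminantNorm ℤ).factorization 3 :=
    family_le_factorization 1155 j hM Nat.prime_three (by norm_num) (by norm_num)
  have hv' : ((2 * j : ℕ) : ℝ) ≤ _ := Nat.cast_le.mpr hv
  have := hv'.trans h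
  push_cast at this
  have hjr : (j₀ : ℝ) + 1 = j := by rw [hjdef]; push_cast; ring
  linarith

/-! ## §4 Admissible constants: `2¹²⁶` at `ε = 1/20`, `2²⁵¹` at `ε = 1/50`, `exp exp (1/(12ε))` in general -/

/-- The body of R2 at exponent `ε` with constant `C` (abbreviation for this section). -/
def Admissible (ε C : ℝ) : Prop :=
  ∀ (W : WeierstrassCurve ℚ) [W.IsElliptic],
    (∀ p : ℕ, p.Prime → ¬ p ^ 2 ∣ W.conductorNorm ℤ) →
    (∃ (a b d : ℤ) (C' : WeierstrassCurve.VariableChange ℚ), IsCoprime a b ∧ a * b * (a + b) ≠ 0 ∧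
      d ∣ 2 ∧ C' • W = freyCurve (d * a) (d * b)) →
    4 ≤ ((W.conductorNorm ℤ).primeFactors.filter (fun p => p ≠ 2 ∧ ¬ p ^ 2 ∣ W.conductorNorm ℤ)).card →
    ((∏ p ∈ (W.conductorNorm ℤ).primeFactors with ¬ p ^ 2 ∣ W.conductorNorm ℤ,
      (W.minimalDiscriminantNorm ℤ).factorization p : ℕ) : ℝ) ≤ C * (W.conductorNorm ℤ : ℝ) ^ ε

/-- R2 says exactly: every `ε > 0` has an admissible constant. [folklore] -/
theorem semistableFrey_iff_admissible :
    ManyPrimeValuationProductSemistableFrey ↔ ∀ ε : ℝ, 0 < ε → ∃ C : ℝ, Admissible ε C := Iff.rfl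

/-- **`C_{1/20} ≥ 2¹²⁶`** (witness `F(M, 2)`, `M = ∏_{3 ≤ p < 1000} p`: `2³³⁴ ≤ T`, `N^{1/20} < 2²⁰⁸`). [folklore] -/
theorem semistableFrey_constant_at_one_twentieth (C : ℝ) (hC : Admissible (1 / 20) C) :
    (2 : ℝ) ^ 126 ≤ C := by
  obtain ⟨M, P, hgt, hlt, h1155, hcard, hP, hprod⟩ := exists_witness
  haveI := family_isElliptic M 2 (witness_one_le hgt)
  obtain ⟨hss, hfrey, h4⟩ := family_in_class M 2 (witness_one_le hgt) (by norm_num) h1155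
  have hT := hC (freyCurve (-1) (32 * (M : ℤ) ^ 2)) hss hfrey h4
  have hTge : (2 : ℝ) ^ 334 ≤ ((∏ p ∈ ((freyCurve (-1) (32 * (M : ℤ) ^ 2)).conductorNorm ℤ).primeFactors
      with ¬ p ^ 2 ∣ (freyCurve (-1) (32 * (M : ℤ) ^ 2)).conductorNorm ℤ,
        ((freyCurve (-1) (32 * (M : ℤ) ^ 2)).minimalDiscriminantNorm ℤ).factorization p : ℕ) : ℝ) := by
    exact_mod_cast witness_valuationProduct_ge hgt hcard hP
  have hroot : ((freyCurve (-1) (32 * (M : ℤ) ^ 2)).conductorNorm ℤ : ℝ) ^ (1 / 20 : ℝ) < (2 : ℝ) ^ 208 := by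
    exact_mod_cast rpow_inv_lt_two_pow (k := 20) (b := 208) (by norm_num)
      (witness_conductorNorm_lt hgt hlt) (by norm_num)
  exact constant_endgame hTge hT (Real.rpow_nonneg (Nat.cast_nonneg _) _) hroot (by norm_num)

/-- **`C_{1/50} ≥ 2²⁵¹`** (same witness, `N^{1/50} < 2⁸³`). [folklore] -/
theorem semistableFrey_constant_at_one_fiftieth (C : ℝ) (hC : Admissible (1 / 50) C) :
    (2 : ℝ) ^ 251 ≤ C := by
  obtain ⟨M, P, hgt, hlt, h1155, hcard, hP, hprod⟩ := exists_witness
  haveI := family_isElliptic M 2 (witness_one_le hgt)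
  obtain ⟨hss, hfrey, h4⟩ := family_in_class M 2 (witness_one_le hgt) (by norm_num) h1155
  have hT := hC (freyCurve (-1) (32 * (M : ℤ) ^ 2)) hss hfrey h4
  have hTge : (2 : ℝ) ^ 334 ≤ ((∏ p ∈ ((freyCurve (-1) (32 * (M : ℤ) ^ 2)).conductorNorm ℤ).primeFactors
      with ¬ p ^ 2 ∣ (freyCurve (-1) (32 * (M : ℤ) ^ 2)).conductorNorm ℤ,
        ((freyCurve (-1) (32 * (M : ℤ) ^ 2)).minimalDiscriminantNorm ℤ).factorization p : ℕ) : ℝ) := by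
    exact_mod_cast witness_valuationProduct_ge hgt hcard hP
  have hroot : ((freyCurve (-1) (32 * (M : ℤ) ^ 2)).conductorNorm ℤ : ℝ) ^ (1 / 50 : ℝ) < (2 : ℝ) ^ 83 := by
    exact_mod_cast rpow_inv_lt_two_pow (k := 50) (b := 83) (by norm_num)
      (witness_conductorNorm_lt hgt hlt) (by norm_num)
  exact constant_endgame hTge hT (Real.rpow_nonneg (Nat.cast_nonneg _) _) hroot (by norm_num)

/-- **`C_ε ≥ exp exp (1/(12ε))` for `0 < ε ≤ 1/320`** — the R2 constant is doubly exponential in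
`1/ε` (witness `F((4^k)#, 2)`, `k = ⌊1/(12ε)⌋`; the parent crux's Chebyshev machinery
`crux_asymptotic_core`, `log_valuationProduct_two_ge`, `log_conductorNorm_two_lt`). [folklore] -/
theorem semistableFrey_constant_ge_exp_exp (ε : ℝ) (hε : 0 < ε) (hε' : ε ≤ 1 / 320) (C : ℝ)
    (hC : Admissible ε C) : Real.exp (Real.exp (1 / (12 * ε))) ≤ C := by
  obtain ⟨k, hk⟩ : ∃ k : ℕ, k = ⌊1 / (12 * ε)⌋₊ := ⟨_, rfl⟩
  have hx0 : (0 : ℝ) ≤ 1 / (12 * ε) := by positivity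
  have hk_le : (k : ℝ) ≤ 1 / (12 * ε) := by rw [hk]; exact Nat.floor_le hx0
  have hk_gt : 1 / (12 * ε) < k + 1 := by rw [hk]; exact Nat.lt_floor_add_one _
  have hk26 : 26 ≤ k := by
    rw [hk]
    refine Nat.le_floor ?_
    rw [le_div_iff₀ (by positivity)]
    push_cast
    nlinarith
  have hεk : 12 * (k : ℝ) * ε ≤ 1 := by
    have := (le_div_iff₀ (by positivity : (0 : ℝ) < 12 * ε)).mp hk_le
    linarith
  obtain ⟨n, hn⟩ : ∃ n : ℕ, n = 4 ^ k := ⟨_, rfl⟩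
  have hn11 : 11 ≤ n := by
    rw [hn]; exact le_trans (by norm_num) (Nat.pow_le_pow_right (by norm_num) (show 2 ≤ k by omega))
  have hM : 1 ≤ primorial n := primorial_pos n
  haveI := family_isElliptic (primorial n) 2 hM
  obtain ⟨hss, hfrey, h4⟩ := family_in_class (primorial n) 2 hM (by norm_num) (dvd_primorial_1155 n hn11)
  have h := hC (freyCurve (-1) (32 * ((primorial n : ℕ) : ℤ) ^ 2)) hss hfrey h4
  have hTlo := log_valuationProduct_two_ge n (by omega)
  have hNhi := log_conductorNorm_two_lt n
  have hθhi := theta_four_pow_le k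
  have hπ := primeCounting_four_pow_ge k (by omega)
  rw [← hn] at hθhi hπ
  have hNpos : (0 : ℝ) < ((freyCurve (-1) (32 * ((primorial n : ℕ) : ℤ) ^ 2)).conductorNorm ℤ : ℝ) :=
    Nat.cast_pos.mpr (WeierstrassCurve.conductorNorm_pos_holds _)
  have hTpos : (0 : ℝ) < ((∏ p ∈ ((freyCurve (-1) (32 * ((primorial n : ℕ) : ℤ) ^ 2)).conductorNorm
      ℤ).primeFactors with ¬ p ^ 2 ∣ (freyCurve (-1) (32 * ((primorial n : ℕ) : ℤ) ^ 2)).conductorNorm ℤ,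
        ((freyCurve (-1) (32 * ((primorial n : ℕ) : ℤ) ^ 2)).minimalDiscriminantNorm ℤ).factorization p
          : ℕ) : ℝ) := by
    have h4' : (0 : ℝ) < (4 : ℝ) ^ (Nat.primeCounting n - 1) := by positivity
    have hge := family_pow_card_le_valuationProduct (primorial n) 2 hM (by norm_num)
      ((Nat.primesLE n).filter (· ≠ 2)) (oddPrimesLE_spec n)
    rw [card_oddPrimesLE n (by omega)] at hge
    have hge' : (4 : ℝ) ^ (Nat.primeCounting n - 1) ≤ ((∏ p ∈ ((freyCurve (-1)
        (32 * ((primorial n : ℕ) : ℤ) ^ 2)).conductorNorm ℤ).primeFactors with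
          ¬ p ^ 2 ∣ (freyCurve (-1) (32 * ((primorial n : ℕ) : ℤ) ^ 2)).conductorNorm ℤ,
        ((freyCurve (-1) (32 * ((primorial n : ℕ) : ℤ) ^ 2)).minimalDiscriminantNorm ℤ).factorization p
          : ℕ) : ℝ) := by exact_mod_cast hge
    exact lt_of_lt_of_le h4' hge'
  have hrpow : 0 < ((freyCurve (-1) (32 * ((primorial n : ℕ) : ℤ) ^ 2)).conductorNorm ℤ : ℝ) ^ ε :=
    Real.rpow_pos_of_pos hNpos ε
  have hCpos : 0 < C := by
    by_contra hle
    push Not at hle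
    have : C * ((freyCurve (-1) (32 * ((primorial n : ℕ) : ℤ) ^ 2)).conductorNorm ℤ : ℝ) ^ ε ≤ 0 :=
      mul_nonpos_of_nonpos_of_nonneg hle hrpow.le
    linarith
  have hlogC : Real.log ((∏ p ∈ ((freyCurve (-1) (32 * ((primorial n : ℕ) : ℤ) ^ 2)).conductorNorm
      ℤ).primeFactors with ¬ p ^ 2 ∣ (freyCurve (-1) (32 * ((primorial n : ℕ) : ℤ) ^ 2)).conductorNorm ℤ,
        ((freyCurve (-1) (32 * ((primorial n : ℕ) : ℤ) ^ 2)).minimalDiscriminantNorm ℤ).factorization p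
          : ℕ) : ℝ) ≤ Real.log C + ε * Real.log ((freyCurve (-1) (32 * ((primorial n : ℕ) : ℤ) ^ 2)).conductorNorm ℤ : ℝ) := by
    have hlog := Real.log_le_log hTpos h
    rwa [Real.log_mul hCpos.ne' hrpow.ne', Real.log_rpow hNpos] at hlog
  have hl2 := Real.log_two_gt_d9
  have hl2' := Real.log_two_lt_d9
  have hL4 : Real.log 4 = 2 * Real.log 2 := by
    rw [show (4 : ℝ) = 2 ^ 2 by norm_num, Real.log_pow]; push_cast; ring
  have hkk : (26 : ℝ) ≤ k := by exact_mod_cast hk26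
  have hat : 40 * (k : ℝ) * (3 : ℝ) ^ k ≤ (4 : ℝ) ^ k := by
    exact_mod_cast forty_mul_three_pow_le k (by omega)
  have ht : (1 : ℝ) ≤ (3 : ℝ) ^ k := one_le_pow₀ (by norm_num)
  have hk0 : (0 : ℝ) < k := by linarith
  have hT' : ((4 : ℝ) ^ k - 4 * k - 1) * Real.log 4 ≤ 2 * k * Real.log ((∏ p ∈ ((freyCurve (-1)
      (32 * ((primorial n : ℕ) : ℤ) ^ 2)).conductorNorm ℤ).primeFactors with
        ¬ p ^ 2 ∣ (freyCurve (-1) (32 * ((primorial n : ℕ) : ℤ) ^ 2)).conductorNorm ℤ,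
        ((freyCurve (-1) (32 * ((primorial n : ℕ) : ℤ) ^ 2)).minimalDiscriminantNorm ℤ).factorization p
          : ℕ) : ℝ) := by
    have h1 : ((4 : ℝ) ^ k - 4 * k - 1) ≤ 2 * k * ((Nat.primeCounting n : ℝ) - 1) := by
      have := (div_le_iff₀ (by positivity : (0 : ℝ) < 2 * k)).mp hπ
      linarith
    have h4pos : 0 < Real.log 4 := Real.log_pos (by norm_num)
    have h2 := mul_le_mul_of_nonneg_right h1 h4pos.le
    have h3 := mul_le_mul_of_nonneg_left hTlo (by positivity : (0 : ℝ) ≤ 2 * k)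
    nlinarith
  have hN' : Real.log ((freyCurve (-1) (32 * ((primorial n : ℕ) : ℤ) ^ 2)).conductorNorm ℤ : ℝ)
      ≤ 6 * Real.log 2 + 3 * Real.log 4 * (4 : ℝ) ^ k := by nlinarith
  have hcore := crux_asymptotic_core hkk hε.le hεk hat ht hl2 hl2' hL4 hT' hlogC hN'
  have hexp : Real.exp (1 / (12 * ε)) < (3 : ℝ) ^ (k + 1) := exp_lt_three_pow hk_gt
  have h3 : (3 : ℝ) ^ (k + 1) = 3 * (3 : ℝ) ^ k := by rw [pow_succ]; ring
  have hfin : Real.exp (1 / (12 * ε)) ≤ Real.log C := by linarith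
  calc Real.exp (Real.exp (1 / (12 * ε))) ≤ Real.exp (Real.log C) := Real.exp_le_exp.mpr hfin
    _ = C := Real.exp_log hCpos

/-- Packaging for provers: whatever mechanism proves R2 must deliver, at `ε = 1/320`, a constant
`C ≥ exp (exp (80/3))` — in particular no argument with constants `exp(O(1/ε))` can be a proof. [folklore] -/
theorem semistableFrey_constant_at_one_320 (h : ManyPrimeValuationProductSemistableFrey) :
    ∃ C : ℝ, Admissible (1 / 320) C ∧ Real.exp (Real.exp (1 / (12 * (1 / 320)))) ≤ C := by
  obtain ⟨C, hC⟩ := h (1 / 320) (by norm_num)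
  exact ⟨C, hC, semistableFrey_constant_ge_exp_exp (1 / 320) (by norm_num) le_rfl C hC⟩

/-! ## §5 Non-vacuity and remarks on the class -/

/-- **The hypotheses of R2 are jointly satisfiable** (so R2 is not vacuously true): `F(1155, 1)` is an
elliptic curve, semistable at every prime, Frey-isomorphic with `d = 1`, with `≥ 4` odd multiplicative
primes. [folklore] -/
theorem class_nonempty :
    ∃ (W : WeierstrassCurve ℚ), W.IsElliptic ∧
      (∀ p : ℕ, p.Prime → ¬ p ^ 2 ∣ W.conductorNorm ℤ) ∧
      (∃ (a b d : ℤ) (C' : WeierstrassCurve.VariableChange ℚ), IsCoprime a b ∧ a * b * (a + b) ≠ 0 ∧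
        d ∣ 2 ∧ C' • W = freyCurve (d * a) (d * b)) ∧
      4 ≤ ((W.conductorNorm ℤ).primeFactors.filter (fun p => p ≠ 2 ∧ ¬ p ^ 2 ∣ W.conductorNorm ℤ)).card :=
  ⟨freyCurve (-1) (32 * ((1155 : ℕ) : ℤ) ^ 1), family_isElliptic 1155 1 (by norm_num),
    family_in_class 1155 1 (by norm_num) le_rfl (dvd_refl _)⟩

/-- On the witnesses the conclusion's product INCLUDES the prime `2` (`2 ∥ N`, multiplicative
reduction at `2` since `32 ∣ b`): `2` is a prime factor of `N(F(M,j))` and `4 ∤ N`. Recorded so that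
provers do not read `T` as an odd-prime product. [folklore] -/
theorem two_mem_primeFactors_family (M j : ℕ) (hM : 1 ≤ M) :
    2 ∈ ((freyCurve (-1) (32 * (M : ℤ) ^ j)).conductorNorm ℤ).primeFactors ∧
      ¬ 2 ^ 2 ∣ (freyCurve (-1) (32 * (M : ℤ) ^ j)).conductorNorm ℤ := by
  refine ⟨?_, family_not_sq_dvd M j hM 2 Nat.prime_two⟩
  rw [family_primeFactors M j hM, Nat.mem_primeFactors]
  refine ⟨Nat.prime_two, ?_, family_param_ne_zero M j hM⟩
  exact Dvd.dvd.mul_right (Dvd.dvd.mul_right (by norm_num : (2 : ℕ) ∣ 32) _) _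

/-! ## §6 Mechanism level and literature (prose)

* The informal mechanism item `EigenformLowerBound` (`‖f_{D,M}‖² ≥ N^{1−o(1)}` for the integrally
  normalised Jacquet–Langlands transfer on `X_0^D(M)`) is the only place where R2 could fail without
  `ABC` failing; it is not a typed statement (definition `ShimuraCurveIntegralForms` wanted), so no
  Lean attack exists.  The parent disprover's `Negative/JlScaling.lean`, `Negative/DefectScaling.lean`
  record that a Petersson lower bound is normalisation-dependent (scaling `s ↦ c•s` moves the mean of
  `log ‖·‖` arbitrarily), i.e. any typed version must pin the INTEGRAL structure — a typing
  constraint for the planner, not a refutation.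
* Literature, this cycle (lit search / galaxy, 2026-08-16): nothing beyond the parent's §7 —
  Prasanna (Ann. of Math. 163, 2006) proves integrality of the ratio `⟨f,f⟩/⟨f_{D,M},f_{D,M}⟩`
  (lower bound `β ≥ 1` for the algebraic part, never a ceiling); Pollack–Weston 2011, BKM
  arXiv:2108.09729, Moakher arXiv:2408.15410 compute `p`-parts of congruence/degree ratios; Pasten
  arXiv:1705.09251 Thm 1.6 is the general-integral-form bound `N^{−5/3} M^{−1}`.  No family with
  `‖f_{D,M}‖² ≤ N^{1−c} ‖f‖²` is in print; kill criterion (iii) of the route (KS defect `≥ c log p` on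
  Galois average) is unproved and, as far as searched, unclaimed.
* Semistability at `2` versus the parent class: by `frey_iff_semistableFrey_and_residual` the re-cut
  loses exactly the Frey curves of triples with `v₂(abc) ≤ 3`; for the route's milestones this costs
  nothing at the `ε`-level only through the `16 ∣ abc` restriction recorded in the crux docstring —
  the classical `abc ⇒ abc₁₆` squaring trick does NOT transfer valuation-product bounds (it replaces
  `rad(abc)` by `rad · |a − b|`), so provers should not expect `R2 ⇒ r2F` cheaply.
-/

end

end Summit.ABC.ABC.Cruxes.ManyPrimeValuationProductSemistableFrey.Disproof
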